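import Summits.BirchSwinnertonDyer.Rank1Residual.Additive.KatoDescentRankOneCountRows
import Summits.BirchSwinnertonDyer.Rank1Residual.Additive.KatoDescentRankOneCountReadingOfLoc
import Summits.BirchSwinnertonDyer.Rank1Residual.Additive.KatoDescentPerrinRiouRatioRankOne
import HarnessLib

set_option autoImplicit false

/-!
# Stub 3 of the Kato–Perrin-Riou skeletons ON THE ROWS from {GZK, modularity-with-level, H2X′} — WITHOUT `Kato2004.thm12_4`
# (seat `bsd-cm-prr-ty1` g17, cell `bsd-cm`; theorems only: no definition, no named fact, no instance, no `sorry`)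

Part 53 of the seat's kernel cut (cruxes stmt-BirchSwinnertonDyer-19945 `EllipticUnitValueSevenOfGZK`, line `kato_perrin_riou_zp` v5;
stmt-BirchSwinnertonDyer-19223 `CccOneLawOnTypeIstarZero`, line `kato_perrin_riou_istar` v5).  The registered v5 skeletons close v4's
stub 3 ON THE ROWS in-file (`rowCount_closed`) by E48/E49 `StrictCount.rankOneCountReading_{classCSeven,istarZero}_of_modularity hGZK hmod
h12 hloc` from the PURE-CITE stub `stub_printFactsKato : Kato2004.thm12_4 ∧ H2X′ ∧ exists_isNewformOf`.  Parts 51–52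
(`KatoDescentPerrinRiouRatioRankOne.lean`: PR-INV|rank one; `KatoDescentRankOneCountReadingOfLoc.lean`: the master and COUNT-X₀|tame)
removed `thm12_4` from every leaf of that cone, Kato's Thm. 12.4 (2) being a TREE THEOREM at the pins in play (finite generation
`IwasawaH1Data.module_finite_of_isCyclotomic`, torsion-freeness `IwasawaH1Data.isTorsionFree`, rank `≤ 1` by cn100's
`rank_le_one_of_rank_integralH1_le_one` ∘ (R1) `LocPKummer.rank_integralH1_le_one`, rank `≥ 1` by the pin's own zeta class —
`KatoDescentDatum.z_ne_zero` at a realised datum, `zetaBody_lift_ne_zero_of_rohrlich` + `PSRohrlichAtLevel.rohrlich_primePow_of_isNewformOf`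
for a lifted family).  THIS FILE assembles the ROW HEADS in the registered conclusions' shapes VERBATIM (planner D692 (b)):
* §1 `rankOneCountReading_tame_of_loc` / `rankOneCountReading_cm_tame_of_loc` `(hGZK) (hlev) (hloc)` — E48 §1's two tame heads
  (conclusions VERBATIM) from {GZK, `IsNewformOf.level_eq_conductorNorm`, H2X′} ONLY: Part 52's master with PR-INV|rank one = Part 51's
  `prInv_of_lev_of_rankOne hlev`, COUNT-X₀ = Part 52's `countX₀_tame_of_gzk_of_loc` (its `Nontrivial I.H` binder met by the master at
  the realised pin), H2X = `hloc.embedding`;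
* §2 ★ `rankOneCountReading_istarZero_of_loc (hGZK) (hlev) (hloc)` — E48 §2's conclusion VERBATIM (E50's `hCrows` body: the rows of
  19223, signed type `(p, I₀*)`, `p ≥ 5`, rank one), row binders discharged exactly as in E48 (`noPTorsion_padic_of_hasSignedLocalType_IstarZero`,
  `addv_of_hasSignedLocalType`, CM `j ∈ ℤ`, GZK);
* §3 ★ `rankOneCountReading_classCSeven_of_loc (hGZK) (hlev) (hloc)` — E48 §3's conclusion VERBATIM (E50's `hC7` body: 𝒞₇ × {7});
* §4 ★ `…_istarZero_of_loc_of_modularity (hGZK) (hmod) (hloc)` / ★ `…_classCSeven_of_loc_of_modularity` — the same keyed to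
  `ModularForms.exists_isNewformOf` (the tree's `IsNewformOf.level_eq_conductorNorm_of_exists_isNewformOf'`, as E49 `hlev_of_modularity`), i.e. to the two SURVIVING conjuncts of `stub_printFactsKato`.
READING OF RECORD after this file: on every row of both cruxes, stub 3 (the v5-recut count reading) ⟸ {GZK, `exists_isNewformOf`,
H2X′ = `Kato2004.exists_iwasawaH2Data_fineSelmerDual_embedding_loc`} — `Kato2004.thm12_4` is NO LONGER an input of the count (it stays
the tree's named fact, untouched).  A v6 `rowCount_closed` would read `fun hGZK ↦ StrictCount.rankOneCountReading_{classCSeven,istarZero}_of_loc_of_modularity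
hGZK stub_printFactsKato.2 stub_printFactsKato.1` over `stub_printFactsKato : H2X′ ∧ exists_isNewformOf` (the planner registers; this
file registers nothing).
HONEST LABEL: theorems only, CONDITIONAL on {GZK, lev / exists_isNewformOf, H2X′}; the registered v5 stubs are NOT touched or
closed; nothing asserted on 19945 / 19223; Perrin-Riou's conjecture and Kato's Main Conjecture untouched; no summit statement is
proved by this seat; BSD is not proved for any curve.
References: [Kato2004Asterisque] (12.2.1) (p. 220), Thm. 12.4 (2) (p. 221), Thm. 12.5 (1) (pp. 221–222), §13.9 (p. 230), (14.9.1) (p. 239),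
(14.9.3) (p. 240), §14.14 (p. 243), Prop. 14.16 (p. 244), (17.13.1) (p. 279); [BurnsKuriharaSano2019] Thm. 7.3, Thm. 7.8 (d);
[GrossZagier1986] Thm. I.7.3; [Mazur1977] Ch. III §5 Step 1 (p. 158); [DiamondShurman2005] Thm. 8.8.3; [RohrlichInventiones1984] Theorem (p. 409).
-/

noncomputable section

open scoped Classical NumberField BigOperators ContRepresentation

open WeierstrassCurve Field IsDedekindDomain NumberField Rat.HeightOneSpectrum Literature.NumberTheory.EllipticCurves
  Literature.NumberTheory.EllipticCurves.ModularForms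
  Literature.NumberTheory.EllipticCurves.Rank1Residual Literature.NumberTheory.EllipticCurves.Rank1Residual.Typed
  Literature.NumberTheory.EllipticCurves.Kato2004 Literature.NumberTheory.EllipticCurves.IwasawaAlgebra
  Literature.NumberTheory.EllipticCurves.Kato2004.EulerSystemValues
  Literature.NumberTheory.GaloisRepresentations Literature.NumberTheory.GaloisRepresentations.DiscreteGaloisModule
  Literature.NumberTheory.DiophantineGeometry
open Summit.BirchSwinnertonDyer.Rank1Residual Summit.BirchSwinnertonDyer.Rank1Residual.Additive
  Summit.BirchSwinnertonDyer.Rank1Residual.X12.O10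
open Summit.BirchSwinnertonDyer.BirchSwinnertonDyer.Theorems.RamifiedSevenEllipticUnits (seven_nsmul_eq_zero_padic)
open Summit.BirchSwinnertonDyer.BirchSwinnertonDyer.Theorems.InertBadLeafKMCPerrinRiou (padicValRat_j_nonneg_of_hasCM)

namespace Summit.BirchSwinnertonDyer.Rank1Residual.Additive.StrictCount

/-! ## §1 The tame all-additive / CM rows from {GZK, lev, H2X′} ONLY -/

section Tame

/-- **STUB 3 ON THE TAME ALL-ADDITIVE ROWS from {GZK, `IsNewformOf.level_eq_conductorNorm`, H2X′} ONLY — no `Kato2004.thm12_4`.**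
Conclusion VERBATIM E48 `rankOneCountReading_tame_of_lev_of_thm12_4`'s (the v5-recut body + the all-additive clause + the tame binder).
Part 52's master over `R W p :=` (all-additive ∧ tame) with PR-INV|rank one from Part 51 (`PerrinRiouUnit.prInv_of_lev_of_rankOne hlev`),
COUNT-X₀ from Part 52 (`countX₀_tame_of_gzk_of_loc`, its `Nontrivial I.H` binder met at the realised pin), H2X from `hloc.embedding`.
CONDITIONAL; the registered v5 stubs are NOT closed.
[cite: Kato2004Asterisque, §12.2 (12.2.1) (p. 220), Thm. 12.4 (2) (p. 221), §13.9 (p. 230), (14.9.1) (p. 239), (14.9.3) (p. 240), §14.14 (p. 243), Prop. 14.16 (p. 244), (17.13.1) (p. 279)]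
[cite: BurnsKuriharaSano2019, Thm. 7.3 (p. 29) and Thm. 7.8 (d) (p. 30)] [cite: GrossZagier1986, Thm. I.7.3] -/
theorem rankOneCountReading_tame_of_loc
    (hGZK : rank_eq_analyticRank_of_analyticRank_le_one)
    (hlev : ∀ (N : ℕ) [NeZero N], IsNewformOf.level_eq_conductorNorm (N := N))
    (hloc : exists_iwasawaH2Data_fineSelmerDual_embedding_loc) :
    ∀ (W : WeierstrassCurve ℚ) [W.IsElliptic] [W.IsGloballyMinimal] (p : ℕ) [Fact p.Prime]
      (D : KatoDescentDatum p) (ℒ : ℚ_[p]),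
      W.analyticRank = 1 → p ≠ 2 → Addv W p → 0 ≤ padicValRat p W.j → ¬ p ∣ W.torsionOrder →
      Finite W.sha →
      (∀ v ∈ W.badPlaces (𝓞 ℚ), ((Rat.HeightOneSpectrum.primesEquiv v : Nat.Primes) : ℕ) ≠ p →
        W.HasAdditiveReductionAt v) →
      (∀ R : (W.baseChange ℚ_[p]).toAffine.Point, p • R = 0 → R = 0) →
      IsKatoZetaDescentDatumOfContra W p D → Kato2004.PRRatio W p ℒ →
      Finite (coinvariants p D.H2) ∧ (ℒ ≠ 0 ↔ D.zetaIndex ≠ 0) ∧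
        ∀ m : ℕ, D.zetaIndex = p ^ m * D.h2Card →
          ℒ.valuation = (m : ℤ) +
            padicValNat p (Nat.card (AddCommGroup.primaryComponent W.sha p)) +
            padicValNat p W.tamagawaProduct := by
  intro W _ _ p _ D ℒ hr hp2 hadd hj htors hsha hall h4 hD hℒ
  refine rankOneCountReading_of_loc_of_rowPred
    (fun W p ↦ (∀ v ∈ W.badPlaces (𝓞 ℚ), ((Rat.HeightOneSpectrum.primesEquiv v : Nat.Primes) : ℕ) ≠ p →
      W.HasAdditiveReductionAt v) ∧ ∀ hp : p.Prime, haveI : Fact p.Prime := ⟨hp⟩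
      ∀ R : (W.baseChange ℚ_[p]).toAffine.Point, p • R = 0 → R = 0)
    (fun _ _ _ _ _ h ↦ h.1) hGZK hlev hloc.embedding (PerrinRiouUnit.prInv_of_lev_of_rankOne hlev) ?_ W p D ℒ hr hp2 hadd hj
    htors hsha ⟨hall, fun _ ↦ h4⟩ hD hℒ
  intro W _ _ p _
  letI : ContinuousSMul ℤ_[p] (W.tateModule p) := TateModule.continuousSMul_padicInt
  intro κ γ hκ hγ I J₀ e₀ hr hp2 hadd hj htors hsha hR hnt he₀ hfin₀
  exact countX₀_tame_of_gzk_of_loc hGZK hloc W p κ γ hκ hγ I J₀ e₀ hr hp2 hadd hj htors hsha (hR.2 Fact.out) hnt he₀ hfin₀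

/-- **STUB 3 ON THE TAME CM ROWS from {GZK, `IsNewformOf.level_eq_conductorNorm`, H2X′} ONLY — no `Kato2004.thm12_4`.**  Conclusion
VERBATIM E48 `rankOneCountReading_cm_tame_of_lev_of_thm12_4`'s (`W.HasCM →` and the tame binder after `Finite W.sha →`); Part 52's master
over `R W p := W.HasCM ∧` tame (all-additive by `forall_badPlaces_hasAdditiveReductionAt_of_hasCM`).  CONDITIONAL; the registered v5
stubs are NOT closed. [cite: Kato2004Asterisque, §12.2 (12.2.1) (p. 220), Thm. 12.4 (2) (p. 221), (14.9.3) (p. 240), §14.14 (p. 243), Prop. 14.16 (p. 244), (17.13.1) (p. 279)]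
[cite: SilvermanATAEC1994, proof of Thm. II.10.5 (p. 172)] [cite: GrossZagier1986, Thm. I.7.3] -/
theorem rankOneCountReading_cm_tame_of_loc
    (hGZK : rank_eq_analyticRank_of_analyticRank_le_one)
    (hlev : ∀ (N : ℕ) [NeZero N], IsNewformOf.level_eq_conductorNorm (N := N))
    (hloc : exists_iwasawaH2Data_fineSelmerDual_embedding_loc) :
    ∀ (W : WeierstrassCurve ℚ) [W.IsElliptic] [W.IsGloballyMinimal] (p : ℕ) [Fact p.Prime]
      (D : KatoDescentDatum p) (ℒ : ℚ_[p]),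
      W.analyticRank = 1 → p ≠ 2 → Addv W p → 0 ≤ padicValRat p W.j → ¬ p ∣ W.torsionOrder →
      Finite W.sha →
      W.HasCM →
      (∀ R : (W.baseChange ℚ_[p]).toAffine.Point, p • R = 0 → R = 0) →
      IsKatoZetaDescentDatumOfContra W p D → Kato2004.PRRatio W p ℒ →
      Finite (coinvariants p D.H2) ∧ (ℒ ≠ 0 ↔ D.zetaIndex ≠ 0) ∧
        ∀ m : ℕ, D.zetaIndex = p ^ m * D.h2Card →
          ℒ.valuation = (m : ℤ) +
            padicValNat p (Nat.card (AddCommGroup.primaryComponent W.sha p)) +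
            padicValNat p W.tamagawaProduct := by
  intro W _ _ p _ D ℒ hr hp2 hadd hj htors hsha hCM h4 hD hℒ
  refine rankOneCountReading_of_loc_of_rowPred
    (fun W p ↦ W.HasCM ∧ ∀ hp : p.Prime, haveI : Fact p.Prime := ⟨hp⟩
      ∀ R : (W.baseChange ℚ_[p]).toAffine.Point, p • R = 0 → R = 0)
    (fun W _ _ p _ h ↦ forall_badPlaces_hasAdditiveReductionAt_of_hasCM W p h.1) hGZK hlev hloc.embedding
    (PerrinRiouUnit.prInv_of_lev_of_rankOne hlev) ?_ W p D ℒ hr hp2 hadd hj htors hsha ⟨hCM, fun _ ↦ h4⟩ hD hℒ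
  intro W _ _ p _
  letI : ContinuousSMul ℤ_[p] (W.tateModule p) := TateModule.continuousSMul_padicInt
  intro κ γ hκ hγ I J₀ e₀ hr hp2 hadd hj htors hsha hR hnt he₀ hfin₀
  exact countX₀_tame_of_gzk_of_loc hGZK hloc W p κ γ hκ hγ I J₀ e₀ hr hp2 hadd hj htors hsha (hR.2 Fact.out) hnt he₀ hfin₀

end Tame

/-! ## §2 The rows of stmt-BirchSwinnertonDyer-19223: signed local type `(p, I₀*)`, `p ≥ 5` -/

section IstarZero

/-- ★ **STUB 3 ON THE ROWS OF 19223 from {GZK, `IsNewformOf.level_eq_conductorNorm`, H2X′} ONLY — no `Kato2004.thm12_4`.**  Conclusion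
VERBATIM E48 `rankOneCountReading_istarZero_of_facts`'s (= E50's `hCrows` body): for every prime `p ≥ 5`, every globally minimal `W/ℚ` of
signed local type `(p, I₀*)` of analytic rank one, every Kato descent datum `D` of the print-exact key and every Kato–Perrin-Riou class
`ℒ`, the v5-recut count reading; row binders discharged as in E48 (`p ≠ 2`, `Addv`, `0 ≤ v_p j`, `p ∤ #W(ℚ)_tors` and the tame binder by
`noPTorsion_padic_of_hasSignedLocalType_IstarZero`, `Finite Ш` by GZK, `W.HasCM`).  CONDITIONAL on {GZK, lev, H2X′}; the registered
v5 stubs are NOT closed; nothing is asserted on 19223.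
[cite: Kato2004Asterisque, §12.2 (12.2.1) (p. 220), Thm. 12.4 (2) (p. 221), Thm. 12.5 (1) (pp. 221–222), §13.9 (p. 230), (14.9.1) (p. 239), (14.9.3) (p. 240), §14.14 (p. 243), Prop. 14.16 (p. 244), (17.13.1) (p. 279)]
[cite: Mazur1977, Ch. III §5, Step 1, p. 158] [cite: BurnsKuriharaSano2019, Thm. 7.3 (p. 29) and Thm. 7.8 (d) (p. 30)] [cite: GrossZagier1986, Thm. I.7.3] -/
theorem rankOneCountReading_istarZero_of_loc
    (hGZK : rank_eq_analyticRank_of_analyticRank_le_one)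
    (hlev : ∀ (N : ℕ) [NeZero N], IsNewformOf.level_eq_conductorNorm (N := N))
    (hloc : exists_iwasawaH2Data_fineSelmerDual_embedding_loc) :
    ∀ (p : ℕ) [Fact p.Prime], 5 ≤ p → ∀ (W : WeierstrassCurve ℚ) [W.IsElliptic] [W.IsGloballyMinimal],
      HasSignedLocalType W p (.Istar 0) → W.analyticRank = 1 →
      ∀ (D : KatoDescentDatum p) (ℒ : ℚ_[p]),
        IsKatoZetaDescentDatumOfContra W p D → Kato2004.PRRatio W p ℒ →
        Finite (coinvariants p D.H2) ∧ (ℒ ≠ 0 ↔ D.zetaIndex ≠ 0) ∧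
          ∀ m : ℕ, D.zetaIndex = p ^ m * D.h2Card →
            ℒ.valuation = (m : ℤ) +
              padicValNat p (Nat.card (AddCommGroup.primaryComponent W.sha p)) +
              padicValNat p W.tamagawaProduct := by
  intro p _ hp5 W _ _ hT hr D ℒ hD hℒ
  have htame := noPTorsion_padic_of_hasSignedLocalType_IstarZero W p hp5 hT
  exact rankOneCountReading_cm_tame_of_loc hGZK hlev hloc W p D ℒ hr (by omega)
    (addv_of_hasSignedLocalType W p hT) (padicValRat_j_nonneg_of_hasCM W p hT.1)
    (not_dvd_torsionOrder_of_noPTorsion W p htame) (hGZK W (by rw [hr])).2 hT.1 htame hD hℒ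

end IstarZero

/-! ## §3 The rows of stmt-BirchSwinnertonDyer-19945: the class 𝒞₇ at `p = 7` -/

section ClassCSeven

/-- ★ **STUB 3 ON THE ROWS OF 19945 from {GZK, `IsNewformOf.level_eq_conductorNorm`, H2X′} ONLY — no `Kato2004.thm12_4`.**  Conclusion
VERBATIM E48 `rankOneCountReading_classCSeven_of_facts`'s (= E50's `hC7` body): for every globally minimal `W ∈ 𝒞₇` (`X12.ClassCSeven`),
every Kato descent datum `D` of the print-exact key at `7` and every Kato–Perrin-Riou class `ℒ` at `7`, the v5-recut count reading at
`(W, 7)`; row binders discharged as in E48 (`7 ≠ 2`, `Addv W 7` by `X12.addv_of_hasCM_of_cmRamified`, `0 ≤ v₇ j`, `7 ∤ #W(ℚ)_tors` and the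
tame binder by `seven_nsmul_eq_zero_padic`, `Finite Ш` by GZK, `W.HasCM`).  CONDITIONAL on {GZK, lev, H2X′}; the registered v5 stubs
are NOT closed; nothing is asserted on 19945.
[cite: Kato2004Asterisque, §12.2 (12.2.1) (p. 220), Thm. 12.4 (2) (p. 221), Thm. 12.5 (1) (pp. 221–222), §13.9 (p. 230), (14.9.1) (p. 239), (14.9.3) (p. 240), §14.14 (p. 243), Prop. 14.16 (p. 244), (17.13.1) (p. 279)]
[cite: Mazur1977, Ch. III §5, Step 1, p. 158] [cite: BurnsKuriharaSano2019, Thm. 7.3 (p. 29) and Thm. 7.8 (d) (p. 30)] [cite: GrossZagier1986, Thm. I.7.3] -/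
theorem rankOneCountReading_classCSeven_of_loc
    (hGZK : rank_eq_analyticRank_of_analyticRank_le_one)
    (hlev : ∀ (N : ℕ) [NeZero N], IsNewformOf.level_eq_conductorNorm (N := N))
    (hloc : exists_iwasawaH2Data_fineSelmerDual_embedding_loc) :
    ∀ (W : WeierstrassCurve ℚ) [W.IsElliptic] [W.IsGloballyMinimal] [Fact (Nat.Prime 7)],
      X12.ClassCSeven W →
      ∀ (D : KatoDescentDatum 7) (ℒ : ℚ_[7]),
        IsKatoZetaDescentDatumOfContra W 7 D → Kato2004.PRRatio W 7 ℒ →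
        Finite (coinvariants 7 D.H2) ∧ (ℒ ≠ 0 ↔ D.zetaIndex ≠ 0) ∧
          ∀ m : ℕ, D.zetaIndex = 7 ^ m * D.h2Card →
            ℒ.valuation = (m : ℤ) +
              padicValNat 7 (Nat.card (AddCommGroup.primaryComponent W.sha 7)) +
              padicValNat 7 W.tamagawaProduct := by
  intro W _ _ _ h7 D ℒ hD hℒ
  have htame : ∀ R : (W.baseChange ℚ_[7]).toAffine.Point, 7 • R = 0 → R = 0 :=
    fun R hR ↦ seven_nsmul_eq_zero_padic W h7.1 h7.2.1 R hR
  exact rankOneCountReading_cm_tame_of_loc hGZK hlev hloc W 7 D ℒ h7.2.2.1 (by norm_num)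
    (X12.addv_of_hasCM_of_cmRamified W 7 h7.1 (by norm_num) (X12.ClassCSeven.cmRamified_seven h7))
    (padicValRat_j_nonneg_of_hasCM W 7 h7.1) (not_dvd_torsionOrder_of_noPTorsion W 7 htame)
    (hGZK W (by rw [h7.2.2.1])).2 h7.1 htame hD hℒ

end ClassCSeven

/-! ## §4 Keyed to modularity-with-level (`exists_isNewformOf`): the two surviving conjuncts of the v5 cite stub -/

section Modularity

/-- ★ **STUB 3 ON THE ROWS OF 19223 from {GZK, `exists_isNewformOf`, H2X′} — the surviving conjuncts of `stub_printFactsKato`.**  §2 with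
Carayol's level read from modularity-with-level (the tree's `IsNewformOf.level_eq_conductorNorm_of_exists_isNewformOf'`, as E49 `hlev_of_modularity`).  A v6 `rowCount_closed` would be
`fun hGZK ↦ rankOneCountReading_istarZero_of_loc_of_modularity hGZK ⟨mod⟩ ⟨loc⟩`.  CONDITIONAL; the registered v5 stubs are NOT closed;
nothing asserted on 19223. [cite: Kato2004Asterisque, Thm. 12.4 (2) (p. 221), §13.9 (p. 230), (14.9.1) (p. 239), §14.14 (p. 243), (17.13.1) (p. 279)]
[cite: DiamondShurman2005, Thm. 8.8.1 and Thm. 8.8.3] [cite: BreuilConradDiamondTaylor2001, Thm. A] -/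
theorem rankOneCountReading_istarZero_of_loc_of_modularity
    (hGZK : rank_eq_analyticRank_of_analyticRank_le_one) (hmod : exists_isNewformOf)
    (hloc : exists_iwasawaH2Data_fineSelmerDual_embedding_loc) :
    ∀ (p : ℕ) [Fact p.Prime], 5 ≤ p → ∀ (W : WeierstrassCurve ℚ) [W.IsElliptic] [W.IsGloballyMinimal],
      HasSignedLocalType W p (.Istar 0) → W.analyticRank = 1 →
      ∀ (D : KatoDescentDatum p) (ℒ : ℚ_[p]),
        IsKatoZetaDescentDatumOfContra W p D → Kato2004.PRRatio W p ℒ →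
        Finite (coinvariants p D.H2) ∧ (ℒ ≠ 0 ↔ D.zetaIndex ≠ 0) ∧
          ∀ m : ℕ, D.zetaIndex = p ^ m * D.h2Card →
            ℒ.valuation = (m : ℤ) +
              padicValNat p (Nat.card (AddCommGroup.primaryComponent W.sha p)) +
              padicValNat p W.tamagawaProduct :=
  rankOneCountReading_istarZero_of_loc hGZK
    (fun N _ ↦ IsNewformOf.level_eq_conductorNorm_of_exists_isNewformOf' (N := N) hmod) hloc

/-- ★ **STUB 3 ON THE ROWS OF 19945 from {GZK, `exists_isNewformOf`, H2X′} — the surviving conjuncts of `stub_printFactsKato`.**  §3 with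
Carayol's level read from modularity-with-level.  A v6 `rowCount_closed` would be
`fun hGZK ↦ rankOneCountReading_classCSeven_of_loc_of_modularity hGZK ⟨mod⟩ ⟨loc⟩`.  CONDITIONAL; the registered v5 stubs are NOT
closed; nothing asserted on 19945. [cite: Kato2004Asterisque, Thm. 12.4 (2) (p. 221), §13.9 (p. 230), (14.9.1) (p. 239), §14.14 (p. 243), (17.13.1) (p. 279)]
[cite: DiamondShurman2005, Thm. 8.8.1 and Thm. 8.8.3] [cite: BreuilConradDiamondTaylor2001, Thm. A] -/
theorem rankOneCountReading_classCSeven_of_loc_of_modularity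
    (hGZK : rank_eq_analyticRank_of_analyticRank_le_one) (hmod : exists_isNewformOf)
    (hloc : exists_iwasawaH2Data_fineSelmerDual_embedding_loc) :
    ∀ (W : WeierstrassCurve ℚ) [W.IsElliptic] [W.IsGloballyMinimal] [Fact (Nat.Prime 7)],
      X12.ClassCSeven W →
      ∀ (D : KatoDescentDatum 7) (ℒ : ℚ_[7]),
        IsKatoZetaDescentDatumOfContra W 7 D → Kato2004.PRRatio W 7 ℒ →
        Finite (coinvariants 7 D.H2) ∧ (ℒ ≠ 0 ↔ D.zetaIndex ≠ 0) ∧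
          ∀ m : ℕ, D.zetaIndex = 7 ^ m * D.h2Card →
            ℒ.valuation = (m : ℤ) +
              padicValNat 7 (Nat.card (AddCommGroup.primaryComponent W.sha 7)) +
              padicValNat 7 W.tamagawaProduct :=
  rankOneCountReading_classCSeven_of_loc hGZK
    (fun N _ ↦ IsNewformOf.level_eq_conductorNorm_of_exists_isNewformOf' (N := N) hmod) hloc

end Modularity

end Summit.BirchSwinnertonDyer.Rank1Residual.Additive.StrictCount

end
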